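import Mathlib
import Summits.Ventures.PercRepro2.K5StarBridgeDict
import Summits.Ventures.PercRepro2.TypedStarMultiC

/-!
# FROM THE DIGIT CERTIFICATES TO THE PIECES, II: THE PIECES (blind cell PercRepro2, p2 g2 / g5,
2026-08-25; the second half of p2 g2's K5StarBridge.lean, split for the olean lane — the `K₃`
analogue of typer-1's K5HyperCoeffs / K5HyperTheorem bridge)

With the dictionary and the encodings of K5StarBridgeDict.lean, a `CertLE` certificate gives the
piece's nonnegativity at every typed set and type map (`le_of_certLE`):

* **`pE_nonneg_of_cert`**, **`pE2_nonneg_of_cert`**, **`pM_nonneg_of_cert`**, **`pBM_nonneg_of_cert`**;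
* **`starCerts5_of_certLE`** — the five certified pieces of one `(marking, T)` from six `CertLE` facts.

Own code; standard axioms.
-/

namespace Summit.Ventures.PercRepro2

open Hub

namespace K5

/-! ## The pieces from the certificates -/

section Pieces

variable {R : Type*} [Field R] [LinearOrder R] [IsStrictOrderedRing R]

/-- **`pE` (in particular `pT1`) from the certificate.** -/
theorem pE_nonneg_of_cert (n : ℕ) (b : Fin 5) (hb : (b : ℕ) = n) (D : Fin 10 → Bool)
    (hc : CertLE (sumT1 (negOn3b n) D) (sumT1 (posOn3b n) D)) (F : Finset (Fin 10)) (τ : Fin 10 → ℕ) :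
    0 ≤ pE F (fun _ => false) τ (CovForm.K3 (R := R) ends5 0 1 2 3 b) D := by
  subst hb
  by_cases hτ : ∀ e ∈ F, τ e ≤ 3
  · obtain ⟨k, hk⟩ := exists_profile F (fun _ => false) τ hτ
    unfold pE
    simp only [mcount_eq b F _ τ k hk]
    have h := le_of_certLE (cSumT1 (cPosOn3b b) D) (cSumT1 (cNegOn3b b) D) (fun k => (cSumT1_lt b D k).1)
      (fun k => (cSumT1_lt b D k).2) (sumT1_pos_eq b D) (sumT1_neg_eq b D) hc k
    unfold cSumT1 at h
    have h' : ((cNegOn3b b D mNone mNone k + cNegOn3b b mNone D mNone k + cNegOn3b b mNone mNone D k : ℕ) : R) ≤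
        ((cPosOn3b b D mNone mNone k + cPosOn3b b mNone D mNone k + cPosOn3b b mNone mNone D k : ℕ) : R) := by
      exact_mod_cast h
    push_cast at h'
    linarith
  · unfold pE mcount
    simp only [typedCount_eq_zero_of_gt3 F _ τ hτ, add_zero, le_refl]

/-- **`pE2` (in particular `pT2`) from the certificate.** -/
theorem pE2_nonneg_of_cert (n : ℕ) (b : Fin 5) (hb : (b : ℕ) = n) (D : Fin 10 → Bool)
    (hc : CertLE (sumT2 (negOn3b n) D) (sumT2 (posOn3b n) D)) (F : Finset (Fin 10)) (τ : Fin 10 → ℕ) :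
    0 ≤ pE2 F (fun _ => false) τ (CovForm.K3 (R := R) ends5 0 1 2 3 b) D := by
  subst hb
  by_cases hτ : ∀ e ∈ F, τ e ≤ 3
  · obtain ⟨k, hk⟩ := exists_profile F (fun _ => false) τ hτ
    unfold pE2
    simp only [mcount_eq b F _ τ k hk]
    have h := le_of_certLE (cSumT2 (cPosOn3b b) D) (cSumT2 (cNegOn3b b) D) (fun k => (cSumT2_lt b D k).1)
      (fun k => (cSumT2_lt b D k).2) (sumT2_pos_eq b D) (sumT2_neg_eq b D) hc k
    unfold cSumT2 at h
    have h' : ((cNegOn3b b D D mNone k + cNegOn3b b D mNone D k + cNegOn3b b mNone D D k : ℕ) : R) ≤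
        ((cPosOn3b b D D mNone k + cPosOn3b b D mNone D k + cPosOn3b b mNone D D k : ℕ) : R) := by
      exact_mod_cast h
    push_cast at h'
    linarith
  · unfold pE2 mcount
    simp only [typedCount_eq_zero_of_gt3 F _ τ hτ, add_zero, le_refl]

/-- **`pM` from the certificate.** -/
theorem pM_nonneg_of_cert (n : ℕ) (b : Fin 5) (hb : (b : ℕ) = n) (D S : Fin 10 → Bool)
    (hc : CertLE (sumM (negOn3b n) D S) (sumM (posOn3b n) D S)) (F : Finset (Fin 10)) (τ : Fin 10 → ℕ) :
    0 ≤ pM F (fun _ => false) τ (CovForm.K3 (R := R) ends5 0 1 2 3 b) D S := by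
  subst hb
  by_cases hτ : ∀ e ∈ F, τ e ≤ 3
  · obtain ⟨k, hk⟩ := exists_profile F (fun _ => false) τ hτ
    unfold pM
    simp only [mcount_eq b F _ τ k hk]
    have hlt : ∀ k, cSumM (cPosOn3b b) D S k < KB3 := fun k => by
      have := cSumM_le cPosOn3b cPosOn3b_le b D S k; rw [KB3_eq]; omega
    have hlt' : ∀ k, cSumM (cNegOn3b b) D S k < KB3 := fun k => by
      have := cSumM_le cNegOn3b cNegOn3b_le b D S k; rw [KB3_eq]; omega
    have h := le_of_certLE (cSumM (cPosOn3b b) D S) (cSumM (cNegOn3b b) D S) hlt hlt'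
      (sumM_pos_eq b D S) (sumM_neg_eq b D S) hc k
    unfold cSumM at h
    have h' : ((cNegOn3b b D S mNone k + cNegOn3b b D mNone S k + cNegOn3b b S D mNone k +
        cNegOn3b b mNone D S k + cNegOn3b b S mNone D k + cNegOn3b b mNone S D k : ℕ) : R) ≤
        ((cPosOn3b b D S mNone k + cPosOn3b b D mNone S k + cPosOn3b b S D mNone k +
        cPosOn3b b mNone D S k + cPosOn3b b S mNone D k + cPosOn3b b mNone S D k : ℕ) : R) := by
      exact_mod_cast h
    push_cast at h'
    linarith
  · unfold pM mcount
    simp only [typedCount_eq_zero_of_gt3 F _ τ hτ, add_zero, le_refl]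

/-- **`pB + pM` from the certificate.** -/
theorem pBM_nonneg_of_cert (n : ℕ) (b : Fin 5) (hb : (b : ℕ) = n) (D S₁ S₂ S₃ S : Fin 10 → Bool)
    (hc : CertLE (sumB (negOn3b n) S₁ S₂ S₃ + sumM (negOn3b n) D S)
      (sumB (posOn3b n) S₁ S₂ S₃ + sumM (posOn3b n) D S)) (F : Finset (Fin 10)) (τ : Fin 10 → ℕ) :
    0 ≤ pB F (fun _ => false) τ (CovForm.K3 (R := R) ends5 0 1 2 3 b) S₁ S₂ S₃ +
      pM F (fun _ => false) τ (CovForm.K3 (R := R) ends5 0 1 2 3 b) D S := by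
  subst hb
  by_cases hτ : ∀ e ∈ F, τ e ≤ 3
  · obtain ⟨k, hk⟩ := exists_profile F (fun _ => false) τ hτ
    unfold pB pM
    simp only [mcount_eq b F _ τ k hk]
    have hlt : ∀ k, cSumB (cPosOn3b b) S₁ S₂ S₃ k + cSumM (cPosOn3b b) D S k < KB3 := fun k => by
      have := cSumB_le cPosOn3b cPosOn3b_le b S₁ S₂ S₃ k
      have := cSumM_le cPosOn3b cPosOn3b_le b D S k; rw [KB3_eq]; omega
    have hlt' : ∀ k, cSumB (cNegOn3b b) S₁ S₂ S₃ k + cSumM (cNegOn3b b) D S k < KB3 := fun k => by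
      have := cSumB_le cNegOn3b cNegOn3b_le b S₁ S₂ S₃ k
      have := cSumM_le cNegOn3b cNegOn3b_le b D S k; rw [KB3_eq]; omega
    have hP : sumB (posOn3b b) S₁ S₂ S₃ + sumM (posOn3b b) D S =
        ∑ k, (cSumB (cPosOn3b b) S₁ S₂ S₃ k + cSumM (cPosOn3b b) D S k) * KB3 ^ idx4 k := by
      rw [sumB_pos_eq, sumM_pos_eq, sum_add_mul2_3]
    have hM : sumB (negOn3b b) S₁ S₂ S₃ + sumM (negOn3b b) D S =
        ∑ k, (cSumB (cNegOn3b b) S₁ S₂ S₃ k + cSumM (cNegOn3b b) D S k) * KB3 ^ idx4 k := by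
      rw [sumB_neg_eq, sumM_neg_eq, sum_add_mul2_3]
    have h := le_of_certLE _ _ hlt hlt' hP hM hc k
    unfold cSumB cSumM at h
    have h' : ((cNegOn3b b S₁ S₂ S₃ k + cNegOn3b b S₁ S₃ S₂ k + cNegOn3b b S₂ S₁ S₃ k + cNegOn3b b S₂ S₃ S₁ k +
        cNegOn3b b S₃ S₁ S₂ k + cNegOn3b b S₃ S₂ S₁ k +
        (cNegOn3b b D S mNone k + cNegOn3b b D mNone S k + cNegOn3b b S D mNone k +
        cNegOn3b b mNone D S k + cNegOn3b b S mNone D k + cNegOn3b b mNone S D k) : ℕ) : R) ≤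
        ((cPosOn3b b S₁ S₂ S₃ k + cPosOn3b b S₁ S₃ S₂ k + cPosOn3b b S₂ S₁ S₃ k + cPosOn3b b S₂ S₃ S₁ k +
        cPosOn3b b S₃ S₁ S₂ k + cPosOn3b b S₃ S₂ S₁ k +
        (cPosOn3b b D S mNone k + cPosOn3b b D mNone S k + cPosOn3b b S D mNone k +
        cPosOn3b b mNone D S k + cPosOn3b b S mNone D k + cPosOn3b b mNone S D k) : ℕ) : R) := by
      exact_mod_cast h
    push_cast at h'
    linarith
  · unfold pB pM mcount
    simp only [typedCount_eq_zero_of_gt3 F _ τ hτ, add_zero, le_refl]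

/-- **The five certified pieces of one `(marking, T)` from six `CertLE` facts** (the certificates
are stated at the `ℕ` values `n, q₁, q₂, q₃` of the marking and the neighbourhood). -/
theorem starCerts5_of_certLE (n : ℕ) (b : Fin 5) (hb : (b : ℕ) = n) (p₁ p₂ p₃ : Fin 5)
    (q₁ q₂ q₃ : ℕ) (hq₁ : (p₁ : ℕ) = q₁) (hq₂ : (p₂ : ℕ) = q₂) (hq₃ : (p₃ : ℕ) = q₃)
    (S : Fin 10 → Bool) (hS : S = pairMask q₁ q₂ ∨ S = pairMask q₁ q₃ ∨ S = pairMask q₂ q₃)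
    (hT1 : CertLE (sumT1 (negOn3b n) (triMask q₁ q₂ q₃)) (sumT1 (posOn3b n) (triMask q₁ q₂ q₃)))
    (hT2 : CertLE (sumT2 (negOn3b n) (triMask q₁ q₂ q₃)) (sumT2 (posOn3b n) (triMask q₁ q₂ q₃)))
    (hM₁ : CertLE (sumM (negOn3b n) (triMask q₁ q₂ q₃) (pairMask q₁ q₂))
      (sumM (posOn3b n) (triMask q₁ q₂ q₃) (pairMask q₁ q₂)))
    (hM₂ : CertLE (sumM (negOn3b n) (triMask q₁ q₂ q₃) (pairMask q₁ q₃))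
      (sumM (posOn3b n) (triMask q₁ q₂ q₃) (pairMask q₁ q₃)))
    (hM₃ : CertLE (sumM (negOn3b n) (triMask q₁ q₂ q₃) (pairMask q₂ q₃))
      (sumM (posOn3b n) (triMask q₁ q₂ q₃) (pairMask q₂ q₃)))
    (hBM : CertLE (sumB (negOn3b n) (pairMask q₁ q₂) (pairMask q₁ q₃) (pairMask q₂ q₃) +
        sumM (negOn3b n) (triMask q₁ q₂ q₃) S)
      (sumB (posOn3b n) (pairMask q₁ q₂) (pairMask q₁ q₃) (pairMask q₂ q₃) +
        sumM (posOn3b n) (triMask q₁ q₂ q₃) S)) :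
    StarCerts5 R b p₁ p₂ p₃ := by
  subst hq₁ hq₂ hq₃
  exact {
    hT1 := fun F τ _ => pE_nonneg_of_cert n b hb _ hT1 F τ
    hT2 := fun F τ _ => pE2_nonneg_of_cert n b hb _ hT2 F τ
    hM := fun F τ _ S' hS' => by
      rcases hS' with rfl | rfl | rfl
      · exact pM_nonneg_of_cert n b hb _ _ hM₁ F τ
      · exact pM_nonneg_of_cert n b hb _ _ hM₂ F τ
      · exact pM_nonneg_of_cert n b hb _ _ hM₃ F τ
    hTvT := ⟨S, hS, fun F τ _ => pBM_nonneg_of_cert n b hb _ _ _ _ _ hBM F τ⟩ }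

end Pieces

end K5

end Summit.Ventures.PercRepro2
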